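import Summits.Ventures.PercRepro.Night2FatDDStruct

/-!
# night-2: the doubly degenerate regime — the shape of a load on a line, unloaded families, unloaded singletons

In the doubly degenerate regime (both `A = π₂ ∖ L` and `M = π₃ ∖ L` of rank `≤ 2`) every load line of a target
`T ⊇ Q ∪ {x}` of a basis pair lies in one of the three lines `clF R₁`, `clF A`, `clF M` (`loaded_target_dd_dichotomy`).
**`load_shape_on_line`** reads the shape of `Y = (T ∖ Q) ∖ {x}` off the load: a distance-1 load (`|R| + 4 = |T ∖ K|`,
non-class) needs two basis points on the line and `Y ⊆ clF S`; a distance-2 load (`|R| + 5 = |T ∖ K|`, class) needs a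
basis point on the line, `|Y ∖ clF S| ≤ 1`, and `Y ⊆ clF S` when only one basis point is on the line.  Hence
**`dload_eq_zero_of_dd_family`**: `Y` is unloaded as soon as, for each of the three lines with `n` basis points on it,
`n ≥ 2 ∧ class → |Y ∖ ℓ| ≥ 2`, `n ≥ 2 ∧ ¬ class → Y ⊄ ℓ` (only needed when `|W ∖ Y| ≥ 3`), `n = 1 ∧ class → Y ⊄ ℓ`;
and **`dload_eq_zero_of_singleton_dd`**: a singleton `{y}` is unloaded when `y` is on no non-class line with two
basis points.  Paper `proofs/NIGHT-2-g35.md` §7.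
-/

namespace PercRepro.Shadow

open PercRepro.ThmH PercRepro.PerFlat

variable {α : Type*} [DecidableEq α] {M : Matroid α} [M.Finite] {G : Finset α}

/-- **The shape of a load on a line** (see the module docstring): `S` is the generating set of the line (rank `≤ 2`),
`R ⊆ clF S` the load line of the target `T`. -/
theorem load_shape_on_line (hG : G ∈ flatsQ M (5 + 1)) (hd : (gr M \ G).card = 2) (hk : kColoops M G = 1)
    {B₀ : Finset α} {w₀ x : α} (hD : G \ clF M B₀ = {w₀, x})
    {B : Finset α} (hB : B ∈ thinMembers M 5 G) (hnP : ¬ bigP M G B) {z : α} (hz : z ∈ G \ clF M B)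
    (hxQ : x ∉ insert z B) {T : Finset α} (hT : T ∈ tgtSets M 5 G B z) (hxT : x ∈ T)
    {R : Finset α} (hR : R ⊆ (T \ coloops M G) \ {w₀, x}) (hR2 : rkN M R = 2)
    {S : Finset α} (hSg : S ⊆ gr M) (hS2 : rkN M S ≤ 2) (hRS : R ⊆ clF M S) :
    (R.card + 4 = (T \ coloops M G).card → 4 ≤ rkN M (insert w₀ (insert x R)) →
      2 ≤ (((insert z B \ coloops M G).erase w₀).filter (fun e => e ∈ clF M S)).card ∧
      ¬ rkN M (insert w₀ (insert x S)) ≤ 3 ∧ (T \ insert z B).erase x ⊆ clF M S) ∧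
    (R.card + 5 = (T \ coloops M G).card → rkN M (insert w₀ (insert x R)) ≤ 3 →
      1 ≤ (((insert z B \ coloops M G).erase w₀).filter (fun e => e ∈ clF M S)).card ∧
      rkN M (insert w₀ (insert x S)) ≤ 3 ∧ (((T \ insert z B).erase x) \ clF M S).card ≤ 1 ∧
      ((((insert z B \ coloops M G).erase w₀).filter (fun e => e ∈ clF M S)).card ≤ 1 →
        (T \ insert z B).erase x ⊆ clF M S)) := by
  have hGg : G ⊆ gr M := (mem_flatsQ.1 hG).1
  have hw₀g : w₀ ∈ gr M := by
    have : w₀ ∈ G \ clF M B₀ := by rw [hD]; exact Finset.mem_insert_self _ _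
    exact hGg (Finset.mem_sdiff.1 this).1
  have hxg : x ∈ gr M := by
    have : x ∈ G \ clF M B₀ := by rw [hD]; exact Finset.mem_insert_of_mem (Finset.mem_singleton_self _)
    exact hGg (Finset.mem_sdiff.1 this).1
  have hRg : R ⊆ gr M := fun e he => mem_gr_of_mem_clF (hRS he)
  have hSS : insert w₀ (insert x S) ⊆ gr M := Finset.insert_subset hw₀g (Finset.insert_subset hxg hSg)
  have hRR : insert w₀ (insert x R) ⊆ gr M := Finset.insert_subset hw₀g (Finset.insert_subset hxg hRg)
  -- a point of `R` in `Q` is a basis point on the line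
  have hRP₀ : R ∩ insert z B ⊆ ((insert z B \ coloops M G).erase w₀).filter (fun e => e ∈ clF M S) := by
    intro r hr
    rw [Finset.mem_inter] at hr
    have h1 := Finset.mem_sdiff.1 (hR hr.1)
    rw [Finset.mem_insert, Finset.mem_singleton, not_or] at h1
    exact Finset.mem_filter.2 ⟨Finset.mem_erase.2 ⟨h1.2.1, Finset.mem_sdiff.2 ⟨hr.2, (Finset.mem_sdiff.1 h1.1).2⟩⟩,
      hRS hr.1⟩
  -- `rk (w₀, x, R) ≤ rk (w₀, x, S)`
  have hle : rkN M (insert w₀ (insert x R)) ≤ rkN M (insert w₀ (insert x S)) := by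
    have hsub : insert w₀ (insert x R) ⊆ clF M (insert w₀ (insert x S)) := by
      intro e he
      rw [Finset.mem_insert, Finset.mem_insert] at he
      rcases he with rfl | rfl | he
      · exact subset_clF_of_subset_gr hSS (Finset.mem_insert_self _ _)
      · exact subset_clF_of_subset_gr hSS (Finset.mem_insert_of_mem (Finset.mem_insert_self _ _))
      · exact clF_mono ((Finset.subset_insert _ _).trans (Finset.subset_insert _ _)) (hRS he)
    have := rkN_mono (M := M) hsub
    rwa [rkN_clF] at this
  refine ⟨fun hRc hncls => ?_, fun hRc hcls => ?_⟩
  · -- distance one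
    obtain ⟨hYR, hRQ2⟩ := sdiff_subset_line_of_dist_one_fat hG hd hk hB hnP hz hT hxT hxQ hR hR2 hRc
    refine ⟨?_, fun h => by omega, hYR.trans hRS⟩
    have := Finset.card_le_card hRP₀
    omega
  · -- distance two
    obtain ⟨hY1, hRQ2⟩ := card_sdiff_line_le_one_of_dist_two hG hd hk hB hnP hz hT hxT hxQ hR hR2 hRc
    have hlev := card_sdiff_coloops_eq_level_add_five hG hd hk hB hnP hz hT
    have hxTQ : x ∈ T \ insert z B := Finset.mem_sdiff.2 ⟨hxT, hxQ⟩
    have hY : ((T \ insert z B).erase x).card + 1 = (T \ insert z B).card := by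
      rw [Finset.card_erase_of_mem hxTQ]
      have : 0 < (T \ insert z B).card := Finset.card_pos.2 ⟨x, hxTQ⟩
      omega
    -- `R ⊆ (R ∩ Q) ∪ (Y ∩ R)`
    have hRsplit : R ⊆ (R ∩ insert z B) ∪ (((T \ insert z B).erase x) ∩ R) := by
      intro r hr
      rw [Finset.mem_union, Finset.mem_inter, Finset.mem_inter]
      by_cases hrQ : r ∈ insert z B
      · exact Or.inl ⟨hr, hrQ⟩
      · refine Or.inr ⟨Finset.mem_erase.2 ⟨?_, Finset.mem_sdiff.2
          ⟨(Finset.mem_sdiff.1 (Finset.mem_sdiff.1 (hR hr)).1).1, hrQ⟩⟩, hr⟩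
        intro h'
        exact (Finset.mem_sdiff.1 (hR hr)).2 (h' ▸ Finset.mem_insert_of_mem (Finset.mem_singleton_self _))
    have hcard := Finset.card_le_card hRsplit
    have hcu := Finset.card_union_le (R ∩ insert z B) (((T \ insert z B).erase x) ∩ R)
    have hYR' : (((T \ insert z B).erase x) ∩ R).card + (((T \ insert z B).erase x) \ R).card =
        ((T \ insert z B).erase x).card := Finset.card_inter_add_card_sdiff _ _
    have hP₀ := Finset.card_le_card hRP₀
    -- the class property transfers to `S`: `clF R = clF S`
    have hcl : clF M R = clF M S := clF_eq_clF_of_subset_clF_of_rkN_le hSg hRS (by omega)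
    have hScls : rkN M (insert w₀ (insert x S)) ≤ 3 := by
      have hsub : insert w₀ (insert x S) ⊆ clF M (insert w₀ (insert x R)) := by
        intro e he
        rw [Finset.mem_insert, Finset.mem_insert] at he
        rcases he with rfl | rfl | he
        · exact subset_clF_of_subset_gr hRR (Finset.mem_insert_self _ _)
        · exact subset_clF_of_subset_gr hRR (Finset.mem_insert_of_mem (Finset.mem_insert_self _ _))
        · have : e ∈ clF M R := by rw [hcl]; exact subset_clF_of_subset_gr hSg he
          exact clF_mono ((Finset.subset_insert _ _).trans (Finset.subset_insert _ _)) this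
      have := rkN_mono (M := M) hsub
      rw [rkN_clF] at this
      omega
    have hYS : ((T \ insert z B).erase x) \ clF M S ⊆ ((T \ insert z B).erase x) \ R :=
      Finset.sdiff_subset_sdiff (Finset.Subset.refl _) hRS
    refine ⟨by omega, hScls, (Finset.card_le_card hYS).trans hY1, fun hn1 => ?_⟩
    -- one basis point on the line: `Y ⊆ R`
    have hYR0 : (((T \ insert z B).erase x) \ R).card = 0 := by omega
    intro e he
    by_contra heS
    have : e ∈ ((T \ insert z B).erase x) \ R := Finset.mem_sdiff.2 ⟨he, fun h => heS (hRS h)⟩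
    have := Finset.card_pos.2 ⟨e, this⟩
    omega

/-- **Unloaded targets of the doubly degenerate regime**: with `Y = (T ∖ Q) ∖ {x}`, `W = (G ∖ Q) ∖ {x}`, `P₀` the basis
points and, for each of the three lines `ℓ` (generated by `S ∈ {R₁, A, M}`), `n = |P₀ ∩ clF S|` and the class property
`rk (w₀, x, S) ≤ 3`: if `n ≥ 2 ∧ class → |Y ∖ clF S| ≥ 2`, `n ≥ 2 ∧ ¬ class → |W ∖ Y| ≥ 3 → Y ⊄ clF S` and
`n = 1 ∧ class → Y ⊄ clF S` hold for all three lines, the target is unloaded. -/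
theorem dload_eq_zero_of_dd_family (hG : G ∈ flatsQ M (5 + 1)) (hd : (gr M \ G).card = 2)
    (hk : kColoops M G = 1) (hs : ∀ e ∈ gr M, ∀ f ∈ gr M, e ≠ f → rkN M {e, f} = 2)
    (hl : ∀ e ∈ gr M, M.Indep {e}) (hfat : (fatClosures M 5 G 2).card ≤ 1) {B₀ : Finset α}
    (hB₀ : B₀ ∈ thinMembers M 5 G) {w₀ x : α} (hD : G \ clF M B₀ = {w₀, x}) (hne : w₀ ≠ x) {R₁ : Finset α}
    (hR₁V : R₁ ⊆ (G \ coloops M G) \ {w₀, x}) (hR₁2 : rkN M R₁ = 2) (hR₁3 : 3 ≤ R₁.card) {c₂ c₃ : α}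
    (hc₂V : c₂ ∈ (G \ coloops M G) \ {w₀, x}) (hc₃V : c₃ ∈ (G \ coloops M G) \ {w₀, x})
    (hc₂ : c₂ ∉ clF M R₁) (hc₃ : c₃ ∉ clF M (insert c₂ R₁))
    (hcover : ∀ e ∈ (G \ coloops M G) \ {w₀, x}, e ∈ clF M (insert c₂ R₁) ∨ e ∈ clF M (insert c₃ R₁))
    (hdeg₂ : rkN M (((G \ coloops M G) \ {w₀, x}).filter
      (fun e => e ∈ clF M (insert c₂ R₁) ∧ e ∉ clF M R₁)) ≤ 2)
    (hdeg₃ : rkN M (((G \ coloops M G) \ {w₀, x}).filter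
      (fun e => e ∈ clF M (insert c₃ R₁) ∧ e ∉ clF M R₁)) ≤ 2)
    {B : Finset α} (hB : B ∈ thinMembers M 5 G) (hnP : ¬ bigP M G B) {z : α} (hz : z ∈ G \ clF M B)
    (hw₀ : w₀ ∈ insert z B) (hxQ : x ∉ insert z B) {T : Finset α} (hT : T ∈ tgtSets M 5 G B z) (hxT : x ∈ T)
    (h₁ : (2 ≤ (((insert z B \ coloops M G).erase w₀).filter (fun e => e ∈ clF M R₁)).card →
        rkN M (insert w₀ (insert x R₁)) ≤ 3 → 2 ≤ (((T \ insert z B).erase x) \ clF M R₁).card) ∧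
      (2 ≤ (((insert z B \ coloops M G).erase w₀).filter (fun e => e ∈ clF M R₁)).card →
        ¬ rkN M (insert w₀ (insert x R₁)) ≤ 3 → 3 ≤ (((G \ insert z B).erase x) \ ((T \ insert z B).erase x)).card →
        ¬ (T \ insert z B).erase x ⊆ clF M R₁) ∧
      ((((insert z B \ coloops M G).erase w₀).filter (fun e => e ∈ clF M R₁)).card = 1 →
        rkN M (insert w₀ (insert x R₁)) ≤ 3 → ¬ (T \ insert z B).erase x ⊆ clF M R₁))
    (h₂ : (2 ≤ (((insert z B \ coloops M G).erase w₀).filter (fun e => e ∈ clF M (((G \ coloops M G) \ {w₀, x}).filter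
          (fun e => e ∈ clF M (insert c₂ R₁) ∧ e ∉ clF M R₁)))).card →
        rkN M (insert w₀ (insert x (((G \ coloops M G) \ {w₀, x}).filter
          (fun e => e ∈ clF M (insert c₂ R₁) ∧ e ∉ clF M R₁)))) ≤ 3 →
        2 ≤ (((T \ insert z B).erase x) \ clF M (((G \ coloops M G) \ {w₀, x}).filter
          (fun e => e ∈ clF M (insert c₂ R₁) ∧ e ∉ clF M R₁))).card) ∧
      (2 ≤ (((insert z B \ coloops M G).erase w₀).filter (fun e => e ∈ clF M (((G \ coloops M G) \ {w₀, x}).filter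
          (fun e => e ∈ clF M (insert c₂ R₁) ∧ e ∉ clF M R₁)))).card →
        ¬ rkN M (insert w₀ (insert x (((G \ coloops M G) \ {w₀, x}).filter
          (fun e => e ∈ clF M (insert c₂ R₁) ∧ e ∉ clF M R₁)))) ≤ 3 →
        3 ≤ (((G \ insert z B).erase x) \ ((T \ insert z B).erase x)).card →
        ¬ (T \ insert z B).erase x ⊆ clF M (((G \ coloops M G) \ {w₀, x}).filter
          (fun e => e ∈ clF M (insert c₂ R₁) ∧ e ∉ clF M R₁))) ∧
      ((((insert z B \ coloops M G).erase w₀).filter (fun e => e ∈ clF M (((G \ coloops M G) \ {w₀, x}).filter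
          (fun e => e ∈ clF M (insert c₂ R₁) ∧ e ∉ clF M R₁)))).card = 1 →
        rkN M (insert w₀ (insert x (((G \ coloops M G) \ {w₀, x}).filter
          (fun e => e ∈ clF M (insert c₂ R₁) ∧ e ∉ clF M R₁)))) ≤ 3 →
        ¬ (T \ insert z B).erase x ⊆ clF M (((G \ coloops M G) \ {w₀, x}).filter
          (fun e => e ∈ clF M (insert c₂ R₁) ∧ e ∉ clF M R₁))))
    (h₃ : (2 ≤ (((insert z B \ coloops M G).erase w₀).filter (fun e => e ∈ clF M (((G \ coloops M G) \ {w₀, x}).filter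
          (fun e => e ∈ clF M (insert c₃ R₁) ∧ e ∉ clF M R₁)))).card →
        rkN M (insert w₀ (insert x (((G \ coloops M G) \ {w₀, x}).filter
          (fun e => e ∈ clF M (insert c₃ R₁) ∧ e ∉ clF M R₁)))) ≤ 3 →
        2 ≤ (((T \ insert z B).erase x) \ clF M (((G \ coloops M G) \ {w₀, x}).filter
          (fun e => e ∈ clF M (insert c₃ R₁) ∧ e ∉ clF M R₁))).card) ∧
      (2 ≤ (((insert z B \ coloops M G).erase w₀).filter (fun e => e ∈ clF M (((G \ coloops M G) \ {w₀, x}).filter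
          (fun e => e ∈ clF M (insert c₃ R₁) ∧ e ∉ clF M R₁)))).card →
        ¬ rkN M (insert w₀ (insert x (((G \ coloops M G) \ {w₀, x}).filter
          (fun e => e ∈ clF M (insert c₃ R₁) ∧ e ∉ clF M R₁)))) ≤ 3 →
        3 ≤ (((G \ insert z B).erase x) \ ((T \ insert z B).erase x)).card →
        ¬ (T \ insert z B).erase x ⊆ clF M (((G \ coloops M G) \ {w₀, x}).filter
          (fun e => e ∈ clF M (insert c₃ R₁) ∧ e ∉ clF M R₁))) ∧
      ((((insert z B \ coloops M G).erase w₀).filter (fun e => e ∈ clF M (((G \ coloops M G) \ {w₀, x}).filter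
          (fun e => e ∈ clF M (insert c₃ R₁) ∧ e ∉ clF M R₁)))).card = 1 →
        rkN M (insert w₀ (insert x (((G \ coloops M G) \ {w₀, x}).filter
          (fun e => e ∈ clF M (insert c₃ R₁) ∧ e ∉ clF M R₁)))) ≤ 3 →
        ¬ (T \ insert z B).erase x ⊆ clF M (((G \ coloops M G) \ {w₀, x}).filter
          (fun e => e ∈ clF M (insert c₃ R₁) ∧ e ∉ clF M R₁)))) :
    dload M 5 G (bigP M G) (dshGT2 M 5 G) T = 0 := by
  by_contra hload
  have hGg : G ⊆ gr M := (mem_flatsQ.1 hG).1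
  have hTG : T ⊆ G := subset_G_of_mem_shadowAt (mem_tgtSets.1 hT).1
  have hQT : insert z B ⊆ T := (mem_tgtSets.1 hT).2.1
  have hw₀T : w₀ ∈ T := hQT hw₀
  have hVg : (G \ coloops M G) \ {w₀, x} ⊆ gr M := fun e he =>
    hGg (Finset.mem_sdiff.1 (Finset.mem_sdiff.1 he).1).1
  have hR₁g : R₁ ⊆ gr M := hR₁V.trans hVg
  have hAg : ((G \ coloops M G) \ {w₀, x}).filter (fun e => e ∈ clF M (insert c₂ R₁) ∧ e ∉ clF M R₁) ⊆ gr M :=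
    (Finset.filter_subset _ _).trans hVg
  have hMg : ((G \ coloops M G) \ {w₀, x}).filter (fun e => e ∈ clF M (insert c₃ R₁) ∧ e ∉ clF M R₁) ⊆ gr M :=
    (Finset.filter_subset _ _).trans hVg
  -- `G ∖ T ⊆ W ∖ Y`, so a distance-1 load needs `|W ∖ Y| ≥ 3`
  have hGT : ∀ hGT3 : 3 ≤ rkN M (G \ T), 3 ≤ (((G \ insert z B).erase x) \ ((T \ insert z B).erase x)).card := by
    intro hGT3
    have hsub : G \ T ⊆ ((G \ insert z B).erase x) \ ((T \ insert z B).erase x) := by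
      intro e he
      rw [Finset.mem_sdiff] at he
      rw [Finset.mem_sdiff, Finset.mem_erase, Finset.mem_sdiff, Finset.mem_erase, Finset.mem_sdiff]
      refine ⟨⟨fun h => he.2 (h ▸ hxT), he.1, fun h => he.2 (hQT h)⟩, fun h => he.2 h.2.1⟩
    exact (hGT3.trans (rkN_le_card _)).trans (Finset.card_le_card hsub)
  obtain ⟨R, hR, hR2, hR3, hline, hcase⟩ := loaded_target_dd_dichotomy hG hd hk hs hl hfat hB₀ hD hne hR₁V hR₁2
    hR₁3 hc₂V hc₃V hc₂ hc₃ hcover hdeg₂ hdeg₃ hTG hw₀T hxT hload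
  -- the shape lemma on the line of `R`
  have key : ∀ S : Finset α, S ⊆ gr M → rkN M S ≤ 2 → R ⊆ clF M S →
      ((2 ≤ (((insert z B \ coloops M G).erase w₀).filter (fun e => e ∈ clF M S)).card →
        rkN M (insert w₀ (insert x S)) ≤ 3 → 2 ≤ (((T \ insert z B).erase x) \ clF M S).card) ∧
      (2 ≤ (((insert z B \ coloops M G).erase w₀).filter (fun e => e ∈ clF M S)).card →
        ¬ rkN M (insert w₀ (insert x S)) ≤ 3 → 3 ≤ (((G \ insert z B).erase x) \ ((T \ insert z B).erase x)).card →
        ¬ (T \ insert z B).erase x ⊆ clF M S) ∧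
      ((((insert z B \ coloops M G).erase w₀).filter (fun e => e ∈ clF M S)).card = 1 →
        rkN M (insert w₀ (insert x S)) ≤ 3 → ¬ (T \ insert z B).erase x ⊆ clF M S)) → False := by
    intro S hSg hS2 hRS hfam
    obtain ⟨hD1, hD2⟩ := load_shape_on_line hG hd hk hD hB hnP hz hxQ hT hxT hR hR2 hSg hS2 hRS
    rcases hcase with ⟨hRc, hGT3, hncls⟩ | ⟨hRc, hcls, -⟩
    · obtain ⟨hn2, hncls', hYS⟩ := hD1 hRc hncls
      exact hfam.2.1 hn2 hncls' (hGT hGT3) hYS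
    · obtain ⟨hn1, hcls', hY1, hY⟩ := hD2 hRc hcls
      rcases Nat.lt_or_ge (((insert z B \ coloops M G).erase w₀).filter (fun e => e ∈ clF M S)).card 2 with h | h
      · exact hfam.2.2 (by omega) hcls' (hY (by omega))
      · have := hfam.1 h hcls'
        omega
  rcases hline with hRL | hRA | hRM
  · exact key R₁ hR₁g hR₁2.le hRL h₁
  · exact key _ hAg hdeg₂ hRA h₂
  · exact key _ hMg hdeg₃ hRM h₃

/-- **Unloaded singletons of the doubly degenerate regime**: a level-2 target `T = Q ∪ {x, y}` is unloaded when `y` is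
on no non-class line (among the three) carrying two basis points. -/
theorem dload_eq_zero_of_singleton_dd (hG : G ∈ flatsQ M (5 + 1)) (hd : (gr M \ G).card = 2)
    (hk : kColoops M G = 1) (hs : ∀ e ∈ gr M, ∀ f ∈ gr M, e ≠ f → rkN M {e, f} = 2)
    (hl : ∀ e ∈ gr M, M.Indep {e}) (hfat : (fatClosures M 5 G 2).card ≤ 1) {B₀ : Finset α}
    (hB₀ : B₀ ∈ thinMembers M 5 G) {w₀ x : α} (hD : G \ clF M B₀ = {w₀, x}) (hne : w₀ ≠ x) {R₁ : Finset α}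
    (hR₁V : R₁ ⊆ (G \ coloops M G) \ {w₀, x}) (hR₁2 : rkN M R₁ = 2) (hR₁3 : 3 ≤ R₁.card) {c₂ c₃ : α}
    (hc₂V : c₂ ∈ (G \ coloops M G) \ {w₀, x}) (hc₃V : c₃ ∈ (G \ coloops M G) \ {w₀, x})
    (hc₂ : c₂ ∉ clF M R₁) (hc₃ : c₃ ∉ clF M (insert c₂ R₁))
    (hcover : ∀ e ∈ (G \ coloops M G) \ {w₀, x}, e ∈ clF M (insert c₂ R₁) ∨ e ∈ clF M (insert c₃ R₁))
    (hdeg₂ : rkN M (((G \ coloops M G) \ {w₀, x}).filter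
      (fun e => e ∈ clF M (insert c₂ R₁) ∧ e ∉ clF M R₁)) ≤ 2)
    (hdeg₃ : rkN M (((G \ coloops M G) \ {w₀, x}).filter
      (fun e => e ∈ clF M (insert c₃ R₁) ∧ e ∉ clF M R₁)) ≤ 2)
    {B : Finset α} (hB : B ∈ thinMembers M 5 G) (hnP : ¬ bigP M G B) {z : α} (hz : z ∈ G \ clF M B)
    (hw₀ : w₀ ∈ insert z B) (hxQ : x ∉ insert z B) {T : Finset α} (hT : T ∈ tgtSets M 5 G B z) (hxT : x ∈ T)
    (hT2 : (T \ insert z B).card = 2) {y : α} (hy : y ∈ (T \ insert z B).erase x)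
    (h₁ : 2 ≤ (((insert z B \ coloops M G).erase w₀).filter (fun e => e ∈ clF M R₁)).card →
      ¬ rkN M (insert w₀ (insert x R₁)) ≤ 3 → y ∉ clF M R₁)
    (h₂ : 2 ≤ (((insert z B \ coloops M G).erase w₀).filter (fun e => e ∈ clF M (((G \ coloops M G) \ {w₀, x}).filter
          (fun e => e ∈ clF M (insert c₂ R₁) ∧ e ∉ clF M R₁)))).card →
        ¬ rkN M (insert w₀ (insert x (((G \ coloops M G) \ {w₀, x}).filter
          (fun e => e ∈ clF M (insert c₂ R₁) ∧ e ∉ clF M R₁)))) ≤ 3 →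
        y ∉ clF M (((G \ coloops M G) \ {w₀, x}).filter (fun e => e ∈ clF M (insert c₂ R₁) ∧ e ∉ clF M R₁)))
    (h₃ : 2 ≤ (((insert z B \ coloops M G).erase w₀).filter (fun e => e ∈ clF M (((G \ coloops M G) \ {w₀, x}).filter
          (fun e => e ∈ clF M (insert c₃ R₁) ∧ e ∉ clF M R₁)))).card →
        ¬ rkN M (insert w₀ (insert x (((G \ coloops M G) \ {w₀, x}).filter
          (fun e => e ∈ clF M (insert c₃ R₁) ∧ e ∉ clF M R₁)))) ≤ 3 →
        y ∉ clF M (((G \ coloops M G) \ {w₀, x}).filter (fun e => e ∈ clF M (insert c₃ R₁) ∧ e ∉ clF M R₁))) :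
    dload M 5 G (bigP M G) (dshGT2 M 5 G) T = 0 := by
  by_contra hload
  have hGg : G ⊆ gr M := (mem_flatsQ.1 hG).1
  have hTG : T ⊆ G := subset_G_of_mem_shadowAt (mem_tgtSets.1 hT).1
  have hQT : insert z B ⊆ T := (mem_tgtSets.1 hT).2.1
  have hw₀T : w₀ ∈ T := hQT hw₀
  have hVg : (G \ coloops M G) \ {w₀, x} ⊆ gr M := fun e he =>
    hGg (Finset.mem_sdiff.1 (Finset.mem_sdiff.1 he).1).1
  have hR₁g : R₁ ⊆ gr M := hR₁V.trans hVg
  have hAg : ((G \ coloops M G) \ {w₀, x}).filter (fun e => e ∈ clF M (insert c₂ R₁) ∧ e ∉ clF M R₁) ⊆ gr M :=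
    (Finset.filter_subset _ _).trans hVg
  have hMg : ((G \ coloops M G) \ {w₀, x}).filter (fun e => e ∈ clF M (insert c₃ R₁) ∧ e ∉ clF M R₁) ⊆ gr M :=
    (Finset.filter_subset _ _).trans hVg
  have hlev := card_sdiff_coloops_eq_level_add_five hG hd hk hB hnP hz hT
  obtain ⟨R, hR, hR2, hR3, hline, hcase⟩ := loaded_target_dd_dichotomy hG hd hk hs hl hfat hB₀ hD hne hR₁V hR₁2
    hR₁3 hc₂V hc₃V hc₂ hc₃ hcover hdeg₂ hdeg₃ hTG hw₀T hxT hload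
  have key : ∀ S : Finset α, S ⊆ gr M → rkN M S ≤ 2 → R ⊆ clF M S →
      (2 ≤ (((insert z B \ coloops M G).erase w₀).filter (fun e => e ∈ clF M S)).card →
        ¬ rkN M (insert w₀ (insert x S)) ≤ 3 → y ∉ clF M S) → False := by
    intro S hSg hS2 hRS hsing
    obtain ⟨hD1, -⟩ := load_shape_on_line hG hd hk hD hB hnP hz hxQ hT hxT hR hR2 hSg hS2 hRS
    rcases hcase with ⟨hRc, -, hncls⟩ | ⟨hRc, -, -⟩
    · obtain ⟨hn2, hncls', hYS⟩ := hD1 hRc hncls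
      exact hsing hn2 hncls' (hYS hy)
    · omega
  rcases hline with hRL | hRA | hRM
  · exact key R₁ hR₁g hR₁2.le hRL h₁
  · exact key _ hAg hdeg₂ hRA h₂
  · exact key _ hMg hdeg₃ hRM h₃

end PercRepro.Shadow
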